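import Summits.Ventures.CertifiedManyBodySolver.Rows.TorusCeilingTTPrimeHom
import HarnessLib

/-!
# Torus ceiling VII(d) — `t–t'` window certificates bound EVERY sector of the `3 × 4` / `3 × 5` PP
# `t–t'` tori (CRT rings; sharp hypothesis)

HONEST FRAMING: first certified bounds; not a superconductivity verdict; every number certified or
labelled float. KERNEL column of the CAL ceiling page at `t' ≠ 0` (cal-3 item K7b), the rows: by the
Chinese remainder theorem the periodic `3 × 4` (`3 × 5`) torus is the ring `ℤ/12` (`ℤ/15`) generated by
`crtHom34 = (x ↦ 4x₀ + 9x₁)` (`crtHom35 = (x ↦ 10x₀ + 6x₁)`), and its DIAGONAL hops are those of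
`φ ∘ D` (`HomTorusTTPrimeModel.diagMap`): `x ↦ 13x₀ − 5x₁`, signed diagonal hops `{±1, ∓5}` mod `12`
(`crtHom34_comp_diagMap`) resp. `x ↦ 16x₀ + 4x₁`, hops `{±1, ±4}` mod `15` (`crtHom35_comp_diagMap`) —
pairwise distinct, so `homTorusTT'_minEnergyOn_upDownSector_div_ge_of_window_certificate_avg`
(`TorusCeilingTTPrimeHom`) applies: a translation + EOM window certificate of the `t–t'` Hubbard model
(data of the tree's `groundEnergy_hubbardTorusTT'_div_ge_of_window_certificate`) whose window has
coordinate spreads `≤ (2, 3)` resp. `≤ (2, 4)` bounds EVERY sector `(N↑, N↓) = (a, b)` of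
`homHubbardTT' crtHom34 t t' U` resp. `homHubbardTT' crtHom35 t t' U`, density rows at the mean filling
(`crt34TT'_…`, `crt35TT'_minEnergyOn_upDownSector_div_ge_of_window_certificate`; transposed generators `crtHom43` /
`crtHom53` for windows drawn in a `4 × 3` / `5 × 3` box: `crt43TT'_…`, `crt53TT'_…`). USE (cal-3
`report/kernel_caps.py` v10): the periodic `3 × 4` / `3 × 5` `t' = −1/4` ED rows in every sector are
KERNEL-admissible caps of the footprint classes `(≤3,4)` / `(≤3,5)`; the numerical rows are ED
references (certified or labelled float), not part of this file. [cite: Han2020Bootstrap, §3]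
[cite: XuEtAl2024, eq. (1)] [cite: KullEtAl2024, §5.3]
-/

noncomputable section

open Matrix Finset
open Literature.MathematicalPhysics.QuantumLattice
open Literature.MathematicalPhysics.QuantumFieldTheory hiding Site
open Literature.MathematicalPhysics.QuantumManyBody.StateRelaxation
open Literature.Probability.LatticeModels
open HubbardWave0
open scoped ComplexOrder ComplexConjugate

namespace Summit.Ventures.CertifiedManyBodySolver.Rows

/-! ### The CRT rings of the `3 × 4` and `3 × 5` PP tori at `t' ≠ 0` -/

section CRT

/-- **`t–t'` window certificate ⇒ EVERY sector of the `3 × 4` PP `t–t'` torus (kernel).** A `t–t'`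
window certificate (data of `groundEnergy_hubbardTorusTT'_div_ge_of_window_certificate`) whose window
`Λ'` has coordinate spreads `≤ 2` and `≤ 3` and contains all king-move neighbours of the inner region
bounds every sector `(N↑, N↓) = (a, b)`, `a, b ≤ 12`, of the `t–t'` Hubbard model of the periodic
`3 × 4` torus in its CRT presentation `homHubbardTT' crtHom34 t t' U` (ring `ℤ/12`, `t`-hops `{±4, ∓3}`,
`t'`-hops `{±1, ∓5}`), density rows at the mean filling:
`c − Σ‖aₖ‖ + (Σ_σ μ_σ)((a + b)/2/12 − ν) ≤ minEnergyOn (szSector (a+b) ((a−b)/2)) / 12`. (Reduce-mode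
certificates of support box `3 × 4` at `t' = −1/4` are admissible.) [cite: Han2020Bootstrap, §3]
[cite: XuEtAl2024, eq. (1)] -/
theorem crt34TT'_minEnergyOn_upDownSector_div_ge_of_window_certificate (t t' U : ℝ) {nu nd : ℕ}
    (hnu : nu ≤ Fintype.card (FermionTorus 1 12)) (hnd : nd ≤ Fintype.card (FermionTorus 1 12))
    {Λ Λ' : Finset (Site 2)} (hΛ : Λ ⊆ Λ')
    (hspread : ∀ x ∈ Λ', ∀ y ∈ Λ', |x 0 - y 0| ≤ (2 : ℤ) ∧ |x 1 - y 1| ≤ (3 : ℤ))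
    (h8 : thicken Λ 1 ⊆ Λ') (h0 : thicken ({0} : Finset (Site 2)) 1 ⊆ Λ') (hz : (0 : Site 2) ∈ Λ')
    (μ : Fin 2 → ℝ) (ν : ℝ)
    {m : Type*} [Fintype m] [DecidableEq m] {Λm : Matrix m m ℂ} (hΛm : Λm.PosSemidef)
    (O : m → FermionOp Λ')
    {κ : Type*} (s : Finset κ) (B : κ → FermionOp Λ)
    {ι : Type*} (tt : Finset ι) (v : ι → Site 2) (hsh : ∀ l, shiftSet (v l) Λ ⊆ Λ') (Y : ι → FermionOp Λ)
    {γ : Type*} (u : Finset γ) (b : γ → ℂ) (cw : γ → List (Orb (PolySite Λ') × Bool))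
    (hcw : ∀ j ∈ u, ladderCharge (cw j) ≠ 0 ∨ ladderSpinCharge (cw j) ≠ 0)
    {δ : Type*} (ah : Finset δ) (dc : δ → ℝ) (V : δ → FermionOp Λ')
    {κ'' : Type*} (w : Finset κ'') (a : κ'' → ℂ) (word : κ'' → List (Orb (PolySite Λ') × Bool)) {c : ℝ}
    (hcert : fermionEmbed (PolySite.incl h0) ((hubbardTTPrimeFermionInteraction t t' U).meanEnergyObs 1) -
        (c : ℂ) • (1 : FermionOp Λ') -
        ∑ σ : Fin 2, ((μ σ : ℝ) : ℂ) • (nAt 0 hz σ - ((ν : ℝ) : ℂ) • (1 : FermionOp Λ')) =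
      gramForm Λm O +
        (∑ k ∈ s, ((hubbardTTPrimeFermionInteraction t t' U).localHamiltonian Λ' * fermionEmbed (PolySite.incl hΛ) (B k) -
            fermionEmbed (PolySite.incl hΛ) (B k) * (hubbardTTPrimeFermionInteraction t t' U).localHamiltonian Λ') +
          ∑ l ∈ tt, (fermionEmbed (PolySite.incl (hsh l)) (fermionEmbed (PolySite.shiftEmb (v l) Λ) (Y l)) -
            fermionEmbed (PolySite.incl hΛ) (Y l)) +
          ∑ j ∈ u, b j • ladderWord (cw j)) +
        (∑ m' ∈ ah, ((dc m' : ℝ) : ℂ) • ((V m')ᴴ - V m') + ∑ k ∈ w, a k • ladderWord (word k))) :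
    c - ∑ k ∈ w, ‖a k‖ + (∑ σ : Fin 2, μ σ) * (((nu : ℝ) + nd) / 2 / 12 - ν) ≤
      (homHubbardTT' crtHom34 t t' U).minEnergyOn (szSector (nu + nd) (((nu : ℝ) - nd) / 2)) / 12 := by
  have hInj' : Set.InjOn crtHom34 ↑Λ' :=
    injOn_ringHom_two_of_spread 12 ![4, 9] (M₀ := 2) (M₁ := 3)
      (fun a' b' h₁ h₂ h₃ h₄ h₅ => by
        simp only [Matrix.cons_val_zero, Matrix.cons_val_one] at h₅
        omega) hspread
  have hd : Function.Injective (signedHop crtHom34) := injective_signedHop_ringHom 12 ![4, 9] (by decide)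
  have hd' : Function.Injective (signedHop (crtHom34.comp diagMap)) := by
    rw [crtHom34_comp_diagMap]
    exact injective_signedHop_ringHom 12 ![13, -5] (by decide)
  have h := homTorusTT'_minEnergyOn_upDownSector_div_ge_of_window_certificate_avg crtHom34 t t' U hd hd' hnu hnd
    hΛ h8 h0 hz hInj' μ ν hΛm O s B tt v hsh Y u b cw hcw ah dc V w a word hcert
  simp only [Nat.cast_ofNat, pow_one] at h
  exact h

/-- **`t–t'` window certificate ⇒ EVERY sector of the `3 × 5` PP `t–t'` torus (kernel)**: as
`crt34TT'_minEnergyOn_upDownSector_div_ge_of_window_certificate` for the CRT ring `ℤ/15` (`t`-hops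
`{±5, ±6}`, `t'`-hops `{±1, ±4}`), windows of coordinate spreads `≤ 2` and `≤ 4`, every `a, b ≤ 15`.
[cite: Han2020Bootstrap, §3] [cite: XuEtAl2024, eq. (1)] -/
theorem crt35TT'_minEnergyOn_upDownSector_div_ge_of_window_certificate (t t' U : ℝ) {nu nd : ℕ}
    (hnu : nu ≤ Fintype.card (FermionTorus 1 15)) (hnd : nd ≤ Fintype.card (FermionTorus 1 15))
    {Λ Λ' : Finset (Site 2)} (hΛ : Λ ⊆ Λ')
    (hspread : ∀ x ∈ Λ', ∀ y ∈ Λ', |x 0 - y 0| ≤ (2 : ℤ) ∧ |x 1 - y 1| ≤ (4 : ℤ))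
    (h8 : thicken Λ 1 ⊆ Λ') (h0 : thicken ({0} : Finset (Site 2)) 1 ⊆ Λ') (hz : (0 : Site 2) ∈ Λ')
    (μ : Fin 2 → ℝ) (ν : ℝ)
    {m : Type*} [Fintype m] [DecidableEq m] {Λm : Matrix m m ℂ} (hΛm : Λm.PosSemidef)
    (O : m → FermionOp Λ')
    {κ : Type*} (s : Finset κ) (B : κ → FermionOp Λ)
    {ι : Type*} (tt : Finset ι) (v : ι → Site 2) (hsh : ∀ l, shiftSet (v l) Λ ⊆ Λ') (Y : ι → FermionOp Λ)
    {γ : Type*} (u : Finset γ) (b : γ → ℂ) (cw : γ → List (Orb (PolySite Λ') × Bool))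
    (hcw : ∀ j ∈ u, ladderCharge (cw j) ≠ 0 ∨ ladderSpinCharge (cw j) ≠ 0)
    {δ : Type*} (ah : Finset δ) (dc : δ → ℝ) (V : δ → FermionOp Λ')
    {κ'' : Type*} (w : Finset κ'') (a : κ'' → ℂ) (word : κ'' → List (Orb (PolySite Λ') × Bool)) {c : ℝ}
    (hcert : fermionEmbed (PolySite.incl h0) ((hubbardTTPrimeFermionInteraction t t' U).meanEnergyObs 1) -
        (c : ℂ) • (1 : FermionOp Λ') -
        ∑ σ : Fin 2, ((μ σ : ℝ) : ℂ) • (nAt 0 hz σ - ((ν : ℝ) : ℂ) • (1 : FermionOp Λ')) =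
      gramForm Λm O +
        (∑ k ∈ s, ((hubbardTTPrimeFermionInteraction t t' U).localHamiltonian Λ' * fermionEmbed (PolySite.incl hΛ) (B k) -
            fermionEmbed (PolySite.incl hΛ) (B k) * (hubbardTTPrimeFermionInteraction t t' U).localHamiltonian Λ') +
          ∑ l ∈ tt, (fermionEmbed (PolySite.incl (hsh l)) (fermionEmbed (PolySite.shiftEmb (v l) Λ) (Y l)) -
            fermionEmbed (PolySite.incl hΛ) (Y l)) +
          ∑ j ∈ u, b j • ladderWord (cw j)) +
        (∑ m' ∈ ah, ((dc m' : ℝ) : ℂ) • ((V m')ᴴ - V m') + ∑ k ∈ w, a k • ladderWord (word k))) :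
    c - ∑ k ∈ w, ‖a k‖ + (∑ σ : Fin 2, μ σ) * (((nu : ℝ) + nd) / 2 / 15 - ν) ≤
      (homHubbardTT' crtHom35 t t' U).minEnergyOn (szSector (nu + nd) (((nu : ℝ) - nd) / 2)) / 15 := by
  have hInj' : Set.InjOn crtHom35 ↑Λ' :=
    injOn_ringHom_two_of_spread 15 ![10, 6] (M₀ := 2) (M₁ := 4)
      (fun a' b' h₁ h₂ h₃ h₄ h₅ => by
        simp only [Matrix.cons_val_zero, Matrix.cons_val_one] at h₅
        omega) hspread
  have hd : Function.Injective (signedHop crtHom35) := injective_signedHop_ringHom 15 ![10, 6] (by decide)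
  have hd' : Function.Injective (signedHop (crtHom35.comp diagMap)) := by
    rw [crtHom35_comp_diagMap]
    exact injective_signedHop_ringHom 15 ![16, 4] (by decide)
  have h := homTorusTT'_minEnergyOn_upDownSector_div_ge_of_window_certificate_avg crtHom35 t t' U hd hd' hnu hnd
    hΛ h8 h0 hz hInj' μ ν hΛm O s B tt v hsh Y u b cw hcw ah dc V w a word hcert
  simp only [Nat.cast_ofNat, pow_one] at h
  exact h

/-- **`t–t'` window certificate ⇒ EVERY sector of the `3 × 4` PP `t–t'` torus, transposed generators**
(`crtHom43 = (x ↦ 9x₀ + 4x₁ mod 12)`, the SAME Cayley graphs as `crtHom34`; windows drawn in a `4 × 3`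
box: coordinate spreads `≤ 3` and `≤ 2`). [cite: Han2020Bootstrap, §3] [cite: XuEtAl2024, eq. (1)] -/
theorem crt43TT'_minEnergyOn_upDownSector_div_ge_of_window_certificate (t t' U : ℝ) {nu nd : ℕ}
    (hnu : nu ≤ Fintype.card (FermionTorus 1 12)) (hnd : nd ≤ Fintype.card (FermionTorus 1 12))
    {Λ Λ' : Finset (Site 2)} (hΛ : Λ ⊆ Λ')
    (hspread : ∀ x ∈ Λ', ∀ y ∈ Λ', |x 0 - y 0| ≤ (3 : ℤ) ∧ |x 1 - y 1| ≤ (2 : ℤ))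
    (h8 : thicken Λ 1 ⊆ Λ') (h0 : thicken ({0} : Finset (Site 2)) 1 ⊆ Λ') (hz : (0 : Site 2) ∈ Λ')
    (μ : Fin 2 → ℝ) (ν : ℝ)
    {m : Type*} [Fintype m] [DecidableEq m] {Λm : Matrix m m ℂ} (hΛm : Λm.PosSemidef)
    (O : m → FermionOp Λ')
    {κ : Type*} (s : Finset κ) (B : κ → FermionOp Λ)
    {ι : Type*} (tt : Finset ι) (v : ι → Site 2) (hsh : ∀ l, shiftSet (v l) Λ ⊆ Λ') (Y : ι → FermionOp Λ)
    {γ : Type*} (u : Finset γ) (b : γ → ℂ) (cw : γ → List (Orb (PolySite Λ') × Bool))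
    (hcw : ∀ j ∈ u, ladderCharge (cw j) ≠ 0 ∨ ladderSpinCharge (cw j) ≠ 0)
    {δ : Type*} (ah : Finset δ) (dc : δ → ℝ) (V : δ → FermionOp Λ')
    {κ'' : Type*} (w : Finset κ'') (a : κ'' → ℂ) (word : κ'' → List (Orb (PolySite Λ') × Bool)) {c : ℝ}
    (hcert : fermionEmbed (PolySite.incl h0) ((hubbardTTPrimeFermionInteraction t t' U).meanEnergyObs 1) -
        (c : ℂ) • (1 : FermionOp Λ') -
        ∑ σ : Fin 2, ((μ σ : ℝ) : ℂ) • (nAt 0 hz σ - ((ν : ℝ) : ℂ) • (1 : FermionOp Λ')) =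
      gramForm Λm O +
        (∑ k ∈ s, ((hubbardTTPrimeFermionInteraction t t' U).localHamiltonian Λ' * fermionEmbed (PolySite.incl hΛ) (B k) -
            fermionEmbed (PolySite.incl hΛ) (B k) * (hubbardTTPrimeFermionInteraction t t' U).localHamiltonian Λ') +
          ∑ l ∈ tt, (fermionEmbed (PolySite.incl (hsh l)) (fermionEmbed (PolySite.shiftEmb (v l) Λ) (Y l)) -
            fermionEmbed (PolySite.incl hΛ) (Y l)) +
          ∑ j ∈ u, b j • ladderWord (cw j)) +
        (∑ m' ∈ ah, ((dc m' : ℝ) : ℂ) • ((V m')ᴴ - V m') + ∑ k ∈ w, a k • ladderWord (word k))) :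
    c - ∑ k ∈ w, ‖a k‖ + (∑ σ : Fin 2, μ σ) * (((nu : ℝ) + nd) / 2 / 12 - ν) ≤
      (homHubbardTT' crtHom43 t t' U).minEnergyOn (szSector (nu + nd) (((nu : ℝ) - nd) / 2)) / 12 := by
  have hInj' : Set.InjOn crtHom43 ↑Λ' :=
    injOn_ringHom_two_of_spread 12 ![9, 4] (M₀ := 3) (M₁ := 2)
      (fun a' b' h₁ h₂ h₃ h₄ h₅ => by
        simp only [Matrix.cons_val_zero, Matrix.cons_val_one] at h₅
        omega) hspread
  have hd : Function.Injective (signedHop crtHom43) := injective_signedHop_ringHom 12 ![9, 4] (by decide)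
  have hd' : Function.Injective (signedHop (crtHom43.comp diagMap)) := by
    rw [crtHom43_comp_diagMap]
    exact injective_signedHop_ringHom 12 ![13, 5] (by decide)
  have h := homTorusTT'_minEnergyOn_upDownSector_div_ge_of_window_certificate_avg crtHom43 t t' U hd hd' hnu hnd
    hΛ h8 h0 hz hInj' μ ν hΛm O s B tt v hsh Y u b cw hcw ah dc V w a word hcert
  simp only [Nat.cast_ofNat, pow_one] at h
  exact h

/-- **`t–t'` window certificate ⇒ EVERY sector of the `3 × 5` PP `t–t'` torus, transposed generators**
(`crtHom53 = (x ↦ 6x₀ + 10x₁ mod 15)`; windows drawn in a `5 × 3` box: coordinate spreads `≤ 4` and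
`≤ 2`). [cite: Han2020Bootstrap, §3] [cite: XuEtAl2024, eq. (1)] -/
theorem crt53TT'_minEnergyOn_upDownSector_div_ge_of_window_certificate (t t' U : ℝ) {nu nd : ℕ}
    (hnu : nu ≤ Fintype.card (FermionTorus 1 15)) (hnd : nd ≤ Fintype.card (FermionTorus 1 15))
    {Λ Λ' : Finset (Site 2)} (hΛ : Λ ⊆ Λ')
    (hspread : ∀ x ∈ Λ', ∀ y ∈ Λ', |x 0 - y 0| ≤ (4 : ℤ) ∧ |x 1 - y 1| ≤ (2 : ℤ))
    (h8 : thicken Λ 1 ⊆ Λ') (h0 : thicken ({0} : Finset (Site 2)) 1 ⊆ Λ') (hz : (0 : Site 2) ∈ Λ')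
    (μ : Fin 2 → ℝ) (ν : ℝ)
    {m : Type*} [Fintype m] [DecidableEq m] {Λm : Matrix m m ℂ} (hΛm : Λm.PosSemidef)
    (O : m → FermionOp Λ')
    {κ : Type*} (s : Finset κ) (B : κ → FermionOp Λ)
    {ι : Type*} (tt : Finset ι) (v : ι → Site 2) (hsh : ∀ l, shiftSet (v l) Λ ⊆ Λ') (Y : ι → FermionOp Λ)
    {γ : Type*} (u : Finset γ) (b : γ → ℂ) (cw : γ → List (Orb (PolySite Λ') × Bool))
    (hcw : ∀ j ∈ u, ladderCharge (cw j) ≠ 0 ∨ ladderSpinCharge (cw j) ≠ 0)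
    {δ : Type*} (ah : Finset δ) (dc : δ → ℝ) (V : δ → FermionOp Λ')
    {κ'' : Type*} (w : Finset κ'') (a : κ'' → ℂ) (word : κ'' → List (Orb (PolySite Λ') × Bool)) {c : ℝ}
    (hcert : fermionEmbed (PolySite.incl h0) ((hubbardTTPrimeFermionInteraction t t' U).meanEnergyObs 1) -
        (c : ℂ) • (1 : FermionOp Λ') -
        ∑ σ : Fin 2, ((μ σ : ℝ) : ℂ) • (nAt 0 hz σ - ((ν : ℝ) : ℂ) • (1 : FermionOp Λ')) =
      gramForm Λm O +
        (∑ k ∈ s, ((hubbardTTPrimeFermionInteraction t t' U).localHamiltonian Λ' * fermionEmbed (PolySite.incl hΛ) (B k) -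
            fermionEmbed (PolySite.incl hΛ) (B k) * (hubbardTTPrimeFermionInteraction t t' U).localHamiltonian Λ') +
          ∑ l ∈ tt, (fermionEmbed (PolySite.incl (hsh l)) (fermionEmbed (PolySite.shiftEmb (v l) Λ) (Y l)) -
            fermionEmbed (PolySite.incl hΛ) (Y l)) +
          ∑ j ∈ u, b j • ladderWord (cw j)) +
        (∑ m' ∈ ah, ((dc m' : ℝ) : ℂ) • ((V m')ᴴ - V m') + ∑ k ∈ w, a k • ladderWord (word k))) :
    c - ∑ k ∈ w, ‖a k‖ + (∑ σ : Fin 2, μ σ) * (((nu : ℝ) + nd) / 2 / 15 - ν) ≤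
      (homHubbardTT' crtHom53 t t' U).minEnergyOn (szSector (nu + nd) (((nu : ℝ) - nd) / 2)) / 15 := by
  have hInj' : Set.InjOn crtHom53 ↑Λ' :=
    injOn_ringHom_two_of_spread 15 ![6, 10] (M₀ := 4) (M₁ := 2)
      (fun a' b' h₁ h₂ h₃ h₄ h₅ => by
        simp only [Matrix.cons_val_zero, Matrix.cons_val_one] at h₅
        omega) hspread
  have hd : Function.Injective (signedHop crtHom53) := injective_signedHop_ringHom 15 ![6, 10] (by decide)
  have hd' : Function.Injective (signedHop (crtHom53.comp diagMap)) := by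
    rw [crtHom53_comp_diagMap]
    exact injective_signedHop_ringHom 15 ![16, -4] (by decide)
  have h := homTorusTT'_minEnergyOn_upDownSector_div_ge_of_window_certificate_avg crtHom53 t t' U hd hd' hnu hnd
    hΛ h8 h0 hz hInj' μ ν hΛm O s B tt v hsh Y u b cw hcw ah dc V w a word hcert
  simp only [Nat.cast_ofNat, pow_one] at h
  exact h

end CRT

end Summit.Ventures.CertifiedManyBodySolver.Rows

end
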